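import Literature.NumberTheory.EllipticCurves.IwasawaTwistModP
import Mathlib.Data.Nat.Choose.Factorization
import HarnessLib

/-!
# The mod-`(p^k, T^J)` Iwasawa twist `M ⊗ (ℤ/p^k)[T]/(T^J)(χ_κ)` of a `p^k`-torsion discrete Galois
# module along a `ℤ_p`-extension `κ` — the level-`p^k` twist carriers (definitions with bodies +
# unfolding lemmas; no named fact)

Topic `NumberTheory/EllipticCurves` (sequel of `IwasawaTwistModP`, the case `k = 1`); namespace
`Literature.NumberTheory.EllipticCurves.ZpExtension` (dot notation `κ.twistModPk ρ hM J`).  DEFINITIONS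
WITH BODIES AND THEOREMS ONLY — nothing is asserted (D-0026).  Cell `bsd-f3-mu` (crux
`KatoDivisibilityX9` = item stmt-BirchSwinnertonDyer-20547, line `graded_euler_loss`, stub `stub_depthX9`),
typing ask **T-es-6 (a)** of MEMO-es §25.3 (definition item `defn-ZpExtension.twistModPk`): the carrier
`M ⊗ Λ/(p^k, T^J)(χ_κ)` of the LEVEL-`p^k` graded core (MEMO-es §15, `A = Λ/(p^{n+1}, ω²)`), in the same
coordinate model as the mod-`p` file: `Fin J → M`, coordinate `i` = coefficient of `T^i`, `T` = the shift
`S = shiftEnd M J`, `γ^a` = `unipotentPow M J a = (1+S)^a`, the exponent of `g ∈ Γ_K` read through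
`ZpExtension.twistExponent`.  All of that vocabulary is REUSED from `IwasawaTwistModP` (not re-declared).

THE ONE CHANGED LEMMA.  On a module killed by `p` one has `(1+S)^{p^m} = 1` on `Fin J → M` as soon as
`J ≤ p^m` (freshman's dream).  On a module killed by `p^k` this needs more room: by Kummer,
`v_p C(p^m, i) = m − v_p(i)`, so `p^k ∣ C(p^m, i)` for all `0 < i < J` iff `v_p(i) ≤ m − k` for `i < J`,
i.e. iff `J ≤ p^{m+1−k}`.  Hence `unipotentPow_prime_pow_eq_one_of_pow_smul :
(∀ x, p^k • x = 0) → J ≤ p^(m+1-k) → (1+S)^{p^m} = 1` (`k = 1` recovers the mod-`p` hypothesis `J ≤ p^m`;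
for `k = 0` the module is `0`), and the twist exponent of level `J` is read modulo `p^{J+k}`
(`J ≤ p^{(J+k)+1−k} = p^{J+1}`); `twistModPk_apply_of_level` shows that ANY admissible level `N`
(`J ≤ p^{N+1−k}`) gives the same operator.

* (private) `prime_pow_dvd_choose_prime_pow` — Kummer: `p^k ∣ C(p^m, i)` for `0 < i < p^{m+1−k}`
  (Mathlib `Nat.factorization_choose_prime_pow`).
* `unipotentPow_prime_pow_eq_one_of_pow_smul`, `unipotentPow_eq_one_of_dvd_of_pow_smul`,
  `unipotentPow_mod_of_pow_smul` — the changed lemma and its two corollaries.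
* `map_shiftEnd_apply`, `map_unipotentPow_apply` — an additive map `M → M'` applied coordinatewise commutes
  with `S` and `(1+S)^a` (functoriality of the carrier in `M`).
* `twistModPkRepresentation κ ρ hM J`, **`κ.twistModPk ρ hM J : DiscreteGaloisModule K (Fin J → M)`** for
  `hM : ∀ x : M, p ^ k • x = 0` — `g` acts by `(1+S)^{κ(g) mod p^{J+k}} ∘ ρ(g)` coordinatewise, i.e.
  `M ⊗ (ℤ/p^k)[T]/(T^J)` with `Γ_K` acting through `ρ ⊗ χ_κ`, `χ_κ(g) = γ^{κ(g)}` the tautological character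
  (continuity: the stabiliser of `x` contains `⋂_i Stab_ρ(x_i) ∩ Gal(K̄/K_{J+k})`).
* API ported verbatim from the model: `twistModPk_apply`, `twistModPk_apply_of_level`,
  `shiftEnd_twistModPk_apply` (`S` is equivariant), `twistModPk_apply_of_mem_layerSubgroup` (`Gal(K̄/K_m)`
  acts through `ρ` alone once `J ≤ p^{m+1−k}` — NO hypothesis `m ≤ J` is needed in this form),
  `twistModPk_apply_of_isTopGenerator` (`γ` acts by `(1+S) ∘ ρ(γ)`), `twistModPk_apply_sub_of_isTopGenerator`;
  the equivariant coordinate maps `twistModPkConstCoeff` (`x ↦ x_0`, reduction mod `T`) and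
  `twistModPkTopCoeff` (`m ↦ m·T^{J−1}`); change of level `twistModPkTruncate` (`J' ≤ J`, `x ↦ x mod T^{J'}`)
  and `twistModPkShiftEmbed` (`x ↦ T^{J−J'} x`), all as Mathlib `ContIntertwiningMap`s.
* COMPATIBILITY WITH THE MOD-`p` MODEL: `twistModPk_apply_eq_twistModP_apply` / **`twistModPk_eq_twistModP`** —
  on a module killed by `p` (viewed as killed by `p^k` for any `k`) the two constructions are EQUAL as
  discrete Galois modules; `twistModPk_one_eq_twistModP` is the case `k = 1`.
* FUNCTORIALITY IN `M` (the reduction morphisms the level-`p^k` tower needs): for a continuous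
  equivariant `f : M → M'`, `twistModPkMap f : 𝒯_J^{(k)}(M) → 𝒯_J^{(k')}(M')` (any two torsion levels),
  `twistModPkToModP f : 𝒯_J^{(k)}(M) → 𝒯_J(M')` into the MODEL's `twistModP` (e.g. along
  `p^{k−1}• : E[p^k] → E[p]`) and `twistModPToModPk f` (e.g. along `E[p] ⊂ E[p^k]`), all `x ↦ f ∘ x`.
* The elliptic-curve case `WeierstrassCurve.modPkTwist W p k κ J` on `Fin J → E[p^k]`,
  `E[p^k] = geomTorsion W ((p : ℤ) ^ k)` (the tree's spelling, as in `Kato2004/IwasawaH1ReductionPk`), with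
  `pow_nsmul_geomTorsion_eq_zero` (`p^k • P = 0` on `E[p^k]`) and the three `modPkTwist_apply…` lemmas.

Not here (items T-es-6 (b)–(d)): the `ω²`-carrier `M ⊗ (ℤ/p^k)[T]/(ω_m²)`, the `T`-adic tower and the
reduction `𝐇¹_Γ(T_pW) → lim← H¹(K, 𝒯_J^{(k)})`, the level-`p^k` pairing coefficients.

References: B. Mazur, K. Rubin, *Kolyvagin systems*, Mem. AMS 799 (2004) §5.3 (the modules `T ⊗ Λ/𝔪^k Λ`
along the tautological character) [MazurRubin2004]; K. Rubin, *Euler Systems* (2000) §II.4 / §VI (twisting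
by characters of `Γ`) [Rubin2000]; L. Washington, *Introduction to Cyclotomic Fields*, §13.1–13.2
(`Λ = ℤ_p⟦T⟧`, `T = γ − 1`, the ideals `(p^k, T^J)` of finite index) [Washington1997]; K. Kato, Astérisque
295 (2004) §13.3 [Kato2004Asterisque]; cell bsd-f3-mu MEMO-es §15, §25.3.
-/

noncomputable section

open scoped Topology ContRepresentation
open Field Filter

universe u

namespace Literature.NumberTheory.EllipticCurves

open Literature.NumberTheory.GaloisRepresentations

/-! ## `(1+S)^{p^m} = 1` on `Fin J → M` for `M` killed by `p^k` and `J ≤ p^{m+1−k}` -/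

section Shift

variable {M : Type*} [AddCommGroup M] {J : ℕ} {p : ℕ} [Fact p.Prime] {k : ℕ}

/-- **Kummer's theorem for `C(p^m, i)`, divisibility form**: `p^k ∣ C(p^m, i)` whenever
`0 < i < p^{m+1−k}` — since `v_p C(p^m, i) = m − v_p(i)` (Mathlib `Nat.factorization_choose_prime_pow`)
and `v_p(i) ≤ m − k` for such `i`.  (For `k = 0` there is nothing to prove.)  Private helper of the
changed lemma below. [folklore] -/
private theorem prime_pow_dvd_choose_prime_pow {m i : ℕ} (hi0 : i ≠ 0) (hi : i < p ^ (m + 1 - k)) :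
    p ^ k ∣ (p ^ m).choose i := by
  have hp : p.Prime := Fact.out
  rcases Nat.eq_zero_or_pos k with rfl | hk
  · rw [pow_zero]
    exact one_dvd _
  have hipm : i ≤ p ^ m :=
    (hi.trans_le (Nat.pow_le_pow_right hp.pos (by omega : m + 1 - k ≤ m))).le
  have hne : (p ^ m).choose i ≠ 0 := (Nat.choose_pos hipm).ne'
  have hvi : i.factorization p < m + 1 - k := by
    have h1 : p ^ i.factorization p ≤ i :=
      Nat.le_of_dvd (Nat.pos_of_ne_zero hi0) (Nat.ordProj_dvd i p)
    exact (Nat.pow_lt_pow_iff_right hp.one_lt).1 (h1.trans_lt hi)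
  rw [hp.pow_dvd_iff_le_factorization hne, Nat.factorization_choose_prime_pow hp hipm hi0]
  omega

omit [Fact p.Prime] in
/-- On `Fin J → M` with `p^k • M = 0`, the scalar `c ∈ ℕ` acts by `0` as soon as `p^k ∣ c`.
[cite: Washington1997, §13.1–§13.2] -/
theorem natCast_moduleEnd_eq_zero_of_pow_smul (hM : ∀ x : M, p ^ k • x = 0) {c : ℕ}
    (hc : p ^ k ∣ c) : ((c : ℕ) : Module.End ℤ (Fin J → M)) = 0 := by
  obtain ⟨d, rfl⟩ := hc
  refine LinearMap.ext fun x => funext fun i => ?_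
  rw [Module.End.natCast_apply, LinearMap.zero_apply, Pi.smul_apply, Pi.zero_apply, mul_comm,
    mul_smul, hM, smul_zero]

/-- **The changed lemma.**  On a module killed by `p^k`, `(1 + S)^{p^m} = 1` on `Fin J → M` as soon as
`J ≤ p^{m+1−k}`: in the binomial expansion the terms with `i ≥ J` vanish because `S^J = 0`, and those
with `0 < i < J` because `p^k ∣ C(p^m, i)` (Kummer, `prime_pow_dvd_choose_prime_pow`).  This is
`(1+T)^{p^m} = 1` in `(ℤ/p^k)[T]/(T^J)`; for `k = 1` it is `unipotentPow_prime_pow_eq_one` (`J ≤ p^m`).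
[cite: Washington1997, §13.1–§13.2] -/
theorem unipotentPow_prime_pow_eq_one_of_pow_smul (hM : ∀ x : M, p ^ k • x = 0) {m : ℕ}
    (hJ : J ≤ p ^ (m + 1 - k)) : unipotentPow M J (p ^ m) = 1 := by
  rw [unipotentPow, add_comm, (Commute.one_right (shiftEnd M J)).add_pow,
    Finset.sum_eq_single_of_mem 0 (Finset.mem_range.2 (Nat.succ_pos _))]
  · rw [pow_zero, one_pow, Nat.choose_zero_right, Nat.cast_one, mul_one, mul_one]
  · intro i _ hi0
    by_cases hiJ : i < J
    · rw [natCast_moduleEnd_eq_zero_of_pow_smul hM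
        (prime_pow_dvd_choose_prime_pow hi0 (lt_of_lt_of_le hiJ hJ)), mul_zero]
    · rw [shiftEnd_pow_eq_zero (not_lt.1 hiJ), zero_mul, zero_mul]

/-- Hence `(1+S)^a = 1` whenever `p^m ∣ a` and `J ≤ p^{m+1−k}` (`p^k • M = 0`).
[cite: Washington1997, §13.1–§13.2] -/
theorem unipotentPow_eq_one_of_dvd_of_pow_smul (hM : ∀ x : M, p ^ k • x = 0) {m a : ℕ}
    (hJ : J ≤ p ^ (m + 1 - k)) (ha : p ^ m ∣ a) : unipotentPow M J a = 1 := by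
  obtain ⟨c, rfl⟩ := ha
  rw [unipotentPow, pow_mul, ← unipotentPow, unipotentPow_prime_pow_eq_one_of_pow_smul hM hJ, one_pow]

/-- Hence `(1+S)^a` only depends on `a` modulo `p^m` (`J ≤ p^{m+1−k}`, `p^k • M = 0`).
[cite: Washington1997, §13.1–§13.2] -/
theorem unipotentPow_mod_of_pow_smul (hM : ∀ x : M, p ^ k • x = 0) {m : ℕ}
    (hJ : J ≤ p ^ (m + 1 - k)) (a : ℕ) :
    unipotentPow M J (a % p ^ m) = unipotentPow M J a := by
  conv_rhs => rw [← Nat.div_add_mod a (p ^ m), unipotentPow_add,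
    unipotentPow_eq_one_of_dvd_of_pow_smul hM hJ (dvd_mul_right _ _), one_mul]

/-- Admissible levels: `J ≤ p^N` as soon as `J ≤ N` (`N < p^N`); private helper. [folklore] -/
private theorem le_prime_pow_of_le {N : ℕ} (h : J ≤ N) : J ≤ p ^ N :=
  h.trans (Nat.lt_pow_self (Fact.out : p.Prime).one_lt).le

/-! ### Functoriality of the carrier in `M` -/

variable {M' : Type*} [AddCommGroup M'] {Φ : Type*} [FunLike Φ M M'] [AddMonoidHomClass Φ M M']

omit [Fact p.Prime] in
/-- An additive map applied coordinatewise commutes with the shifts: `f ∘ (S x) = S (f ∘ x)`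
(any `AddMonoidHomClass`, e.g. a `ContIntertwiningMap` of discrete modules). [cite: Washington1997, §13.1–§13.2] -/
theorem map_shiftEnd_apply (f : Φ) (x : Fin J → M) :
    (fun i => f (shiftEnd M J x i)) = shiftEnd M' J (fun i => f (x i)) := by
  funext i
  simp only [shiftEnd_apply]
  by_cases h : (i : ℕ) = 0
  · rw [dif_pos h, dif_pos h, map_zero]
  · rw [dif_neg h, dif_neg h]

omit [Fact p.Prime] in
/-- An additive map applied coordinatewise commutes with the unipotent operators:
`f ∘ ((1+S)^a x) = (1+S)^a (f ∘ x)`. [cite: Washington1997, §13.1–§13.2] -/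
theorem map_unipotentPow_apply (f : Φ) (a : ℕ) (x : Fin J → M) :
    (fun i => f (unipotentPow M J a x i)) = unipotentPow M' J a (fun i => f (x i)) := by
  induction a generalizing x with
  | zero => simp
  | succ a ih =>
    rw [ZpExtension.unipotentPow_succ_apply, ZpExtension.unipotentPow_succ_apply, ← ih,
      ← map_shiftEnd_apply f]
    funext i
    exact map_add f _ _

end Shift

/-! ## The level-`p^k` twisted representation and its continuity -/

namespace ZpExtension

variable {K : Type u} [Field K] {p : ℕ} [Fact p.Prime] (κ : ZpExtension K p)

variable {M : Type u} [AddCommGroup M] [TopologicalSpace M] [DiscreteTopology M] {k : ℕ}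

omit [TopologicalSpace M] [DiscreteTopology M] in
/-- For `p^k • M = 0` and an admissible level `N` (`J ≤ p^{N+1−k}`), the unipotent operator of the
exponent read at any higher level `N' ≥ N` equals the one read at level `N`
(`twistExponent N' g ≡ twistExponent N g (mod p^N)`). [cite: Washington1997, §13.1–§13.2] -/
theorem unipotentPow_twistExponent_of_level_le (hM : ∀ x : M, p ^ k • x = 0) {J N N' : ℕ}
    (hN : J ≤ p ^ (N + 1 - k)) (hNN' : N ≤ N') (g : absoluteGaloisGroup K) :
    unipotentPow M J (κ.twistExponent N' g) = unipotentPow M J (κ.twistExponent N g) := by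
  rw [← κ.twistExponent_mod_pow N' hNN' g, unipotentPow_mod_of_pow_smul hM hN]

omit [TopologicalSpace M] [DiscreteTopology M] in
/-- Any two admissible levels give the same unipotent operator `(1+S)^{κ(g)}` on `Fin J → M`
(`p^k • M = 0`). [cite: Washington1997, §13.1–§13.2] -/
theorem unipotentPow_twistExponent_eq_of_level (hM : ∀ x : M, p ^ k • x = 0) {J N N' : ℕ}
    (hN : J ≤ p ^ (N + 1 - k)) (hN' : J ≤ p ^ (N' + 1 - k)) (g : absoluteGaloisGroup K) :
    unipotentPow M J (κ.twistExponent N g) = unipotentPow M J (κ.twistExponent N' g) := by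
  rcases le_total N N' with h | h
  · exact (κ.unipotentPow_twistExponent_of_level_le hM hN h g).symm
  · exact κ.unipotentPow_twistExponent_of_level_le hM hN' h g

omit [TopologicalSpace M] [DiscreteTopology M] in
/-- The definitional level `J + k` is admissible: `J ≤ p^{(J+k)+1−k} = p^{J+1}`; private helper. [folklore] -/
private theorem le_prime_pow_level (J : ℕ) : J ≤ p ^ (J + k + 1 - k) :=
  le_prime_pow_of_le (by omega)

/-- The **mod-`(p^k, T^J)` Iwasawa twist as a representation**: `g ∈ Γ_K` acts on `Fin J → M`
(`= M ⊗ (ℤ/p^k)[T]/(T^J)`) by `(1+S)^{κ(g)} ∘ ρ(g)`, i.e. by `ρ(g) ⊗ (1+T)^{κ(g)}` — the action of `Γ_K`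
on `M ⊗ Λ/(p^k, T^J)(χ_κ)` with `Λ = ℤ_p⟦T⟧`, `T = γ − 1`, `χ_κ(g) = γ^{κ(g)}` the tautological character.
The exponent is read modulo `p^{J+k}`; well defined because `p^k • M = 0` (so `(1+S)^{p^{J+k}} = 1`).
Ref: Mazur–Rubin, Mem. AMS 799 (2004) §5.3 (`T ⊗ Λ/𝔪^kΛ`); Rubin, *Euler Systems* §II.4.
[cite: MazurRubin2004, §5.3] -/
def twistModPkRepresentation (ρ : DiscreteGaloisModule K M) (hM : ∀ x : M, p ^ k • x = 0) (J : ℕ) :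
    Representation ℤ (absoluteGaloisGroup K) (Fin J → M) where
  toFun g := unipotentPow M J (κ.twistExponent (J + k) g) * (ρ g).compLeft (Fin J)
  map_one' := by
    rw [twistExponent_one, unipotentPow_zero, one_mul, map_one, compLeft_one]
  map_mul' g h := by
    rw [twistExponent_mul, unipotentPow_mod_of_pow_smul hM (le_prime_pow_level J), unipotentPow_add,
      map_mul, compLeft_mul, mul_assoc, ← mul_assoc (unipotentPow M J (κ.twistExponent (J + k) h)),
      unipotentPow_mul_compLeft, mul_assoc, mul_assoc]

/-- Unfolding lemma for `twistModPkRepresentation`. [cite: MazurRubin2004, §5.3] -/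
theorem twistModPkRepresentation_apply (ρ : DiscreteGaloisModule K M) (hM : ∀ x : M, p ^ k • x = 0)
    (J : ℕ) (g : absoluteGaloisGroup K) (x : Fin J → M) :
    κ.twistModPkRepresentation ρ hM J g x =
      unipotentPow M J (κ.twistExponent (J + k) g) (fun i => ρ g (x i)) := rfl

/-- **`𝒯_J^{(k)}(ρ, κ) = M ⊗ (ℤ/p^k)[T]/(T^J)(χ_κ)` as a DISCRETE `Γ_K`-MODULE** (`κ.twistModPk ρ hM J`,
`hM : ∀ x, p^k • x = 0`): the representation `twistModPkRepresentation` is continuous for the discrete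
topology on `Fin J → M`, the stabiliser of `x` containing `⋂_i Stab_ρ(x_i) ∩ Gal(K̄/K_{J+k})`
(`κ.layerSubgroup (J + k)` acts trivially on the twist since `(1+S)^{p^{J+k}} = 1`).  This is the level-`p^k`
twist carrier of MEMO-es §25.3 (T-es-6 (a)): the `(ℤ/p^k)[T]/(T^J)`-model of `M ⊗ Λ/(p^k, T^J)` with `Γ`
acting through the tautological character, on which the tree's `galoisCohomology`, `H1 T U`, localisation
and Selmer structures are evaluated.  For `k = 1` it IS the model `κ.twistModP` (`twistModPk_one_eq_twistModP`).
Ref: Mazur–Rubin, Mem. AMS 799 (2004) §5.3; Kato, Astérisque 295 §13.3. [cite: MazurRubin2004, §5.3] -/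
def twistModPk (ρ : DiscreteGaloisModule K M) (hM : ∀ x : M, p ^ k • x = 0) (J : ℕ) :
    DiscreteGaloisModule K (Fin J → M) :=
  ContinuousRep.ofStabilizerMemNhdsOne (κ.twistModPkRepresentation ρ hM J) fun x => by
    have h1 : (κ.layerSubgroup (J + k) : Set (absoluteGaloisGroup K)) ∈ 𝓝 (1 : absoluteGaloisGroup K) :=
      (κ.isOpen_layerSubgroup (J + k)).mem_nhds (one_mem _)
    have h2 : (⋂ i : Fin J, {σ : absoluteGaloisGroup K | ρ σ (x i) = x i}) ∈
        𝓝 (1 : absoluteGaloisGroup K) :=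
      (Filter.iInter_mem).2 fun i => ρ.setOf_apply_eq_mem_nhds_one (x i)
    filter_upwards [h1, h2] with σ hσ1 hσ2
    simp only [Set.mem_iInter, Set.mem_setOf_eq] at hσ2
    simp only [twistModPkRepresentation_apply,
      unipotentPow_eq_one_of_dvd_of_pow_smul hM (le_prime_pow_level J)
        (κ.prime_pow_dvd_twistExponent le_rfl hσ1),
      Module.End.one_apply]
    funext i
    exact hσ2 i

variable (ρ : DiscreteGaloisModule K M) (hM : ∀ x : M, p ^ k • x = 0) (J : ℕ)

/-- Unfolding lemma: `g` acts on `𝒯_J^{(k)}` by `(1+S)^{κ(g) mod p^{J+k}}` after `ρ(g)` coordinatewise.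
[cite: MazurRubin2004, §5.3] -/
theorem twistModPk_apply (g : absoluteGaloisGroup K) (x : Fin J → M) :
    κ.twistModPk ρ hM J g x = unipotentPow M J (κ.twistExponent (J + k) g) (fun i => ρ g (x i)) := rfl

/-- **Level independence**: for ANY admissible level `N` (`J ≤ p^{N+1−k}`), `g` acts on `𝒯_J^{(k)}` by
`(1+S)^{κ(g) mod p^N}` after `ρ(g)` — the twist character `g ↦ (1+T)^{κ(g)} ∈ ((ℤ/p^k)[T]/(T^J))^×`
factors through `Γ/Γ^{p^N}`. [cite: Washington1997, §13.1–§13.2] -/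
theorem twistModPk_apply_of_level {N : ℕ} (hN : J ≤ p ^ (N + 1 - k)) (g : absoluteGaloisGroup K)
    (x : Fin J → M) :
    κ.twistModPk ρ hM J g x = unipotentPow M J (κ.twistExponent N g) (fun i => ρ g (x i)) := by
  rw [twistModPk_apply, κ.unipotentPow_twistExponent_eq_of_level hM (le_prime_pow_level J) hN]

/-- **`S` (multiplication by `T`) is `Γ_K`-equivariant on `𝒯_J^{(k)}`**: `𝒯_J^{(k)}` is a module over
`(ℤ/p^k)[T]/(T^J)` with a `T`-linear Galois action. [cite: Washington1997, §13.1–§13.2] -/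
theorem shiftEnd_twistModPk_apply (g : absoluteGaloisGroup K) (x : Fin J → M) :
    shiftEnd M J (κ.twistModPk ρ hM J g x) = κ.twistModPk ρ hM J g (shiftEnd M J x) := by
  change (shiftEnd M J * (unipotentPow M J (κ.twistExponent (J + k) g) * (ρ g).compLeft (Fin J))) x =
    (unipotentPow M J (κ.twistExponent (J + k) g) * (ρ g).compLeft (Fin J) * shiftEnd M J) x
  rw [← mul_assoc, (commute_shiftEnd_unipotentPow _).eq, mul_assoc, shiftEnd_mul_compLeft,
    mul_assoc]

/-- **`Gal(K̄/K_m)` acts on `𝒯_J^{(k)}` through `ρ` alone when `J ≤ p^{m+1−k}`** (the twist character is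
trivial on `κ.layerSubgroup m` modulo `(p^k, T^J)`: `(1+T)^{p^m} = 1` in `(ℤ/p^k)[T]/(T^J)`).  No
hypothesis `m ≤ J` is needed (the exponent may be read at level `m` itself).  For `k = 1` this is
MU-TRANSFER-PROOF (F8) / `twistModP_apply_of_mem_layerSubgroup`. [cite: Washington1997, §13.1–§13.2] -/
theorem twistModPk_apply_of_mem_layerSubgroup {m : ℕ} (hJ : J ≤ p ^ (m + 1 - k))
    {g : absoluteGaloisGroup K} (hg : g ∈ κ.layerSubgroup m) (x : Fin J → M) :
    κ.twistModPk ρ hM J g x = fun i => ρ g (x i) := by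
  rw [κ.twistModPk_apply_of_level ρ hM J hJ,
    unipotentPow_eq_one_of_dvd_of_pow_smul hM hJ (κ.prime_pow_dvd_twistExponent le_rfl hg),
    Module.End.one_apply]

/-- **A topological generator `γ` (`κ γ = 1`) acts on `𝒯_J^{(k)}` by `(1 + S) ∘ ρ(γ)`**: on `ρ(γ)`-fixed
coordinates, `T = γ − 1` IS the shift. [cite: Washington1997, §13.1–§13.2] -/
theorem twistModPk_apply_of_isTopGenerator {γ : absoluteGaloisGroup K} (hγ : κ.IsTopGenerator γ)
    (x : Fin J → M) :
    κ.twistModPk ρ hM J γ x = (1 + shiftEnd M J) (fun i => ρ γ (x i)) := by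
  rcases Nat.eq_zero_or_pos J with rfl | hJ
  · exact Subsingleton.elim _ _
  · haveI : Fact (1 < p ^ (J + k)) :=
      ⟨Nat.one_lt_pow (by omega) (Fact.out : p.Prime).one_lt⟩
    have hexp : κ.twistExponent (J + k) γ = 1 := by
      rw [twistExponent, show κ γ = Multiplicative.ofAdd 1 from hγ, toAdd_ofAdd, map_one,
        ZMod.val_one]
    rw [twistModPk_apply, hexp, unipotentPow, pow_one]

/-- On `𝒯_J^{(k)}`, `γ − 1` acts as the shift composed with `ρ(γ)`:
`γ•x − ρ(γ)x = S(ρ(γ) x)`. [cite: Washington1997, §13.1–§13.2] -/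
theorem twistModPk_apply_sub_of_isTopGenerator {γ : absoluteGaloisGroup K} (hγ : κ.IsTopGenerator γ)
    (x : Fin J → M) :
    κ.twistModPk ρ hM J γ x - (fun i => ρ γ (x i)) = shiftEnd M J (fun i => ρ γ (x i)) := by
  rw [twistModPk_apply_of_isTopGenerator κ ρ hM J hγ, LinearMap.add_apply, Module.End.one_apply,
    add_sub_cancel_left]

/-! ### Comparison with the mod-`p` model `twistModP` -/

/-- On a module killed by `p` (hence by `p^k`, or just assumed so), the level-`p^k` twist and the
mod-`p` model act identically: both are `(1+S)^{κ(g)} ∘ ρ(g)` with the exponent read at an admissible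
level. [cite: Washington1997, §13.1–§13.2] -/
theorem twistModPk_apply_eq_twistModP_apply (hM1 : ∀ x : M, p • x = 0) (g : absoluteGaloisGroup K)
    (x : Fin J → M) :
    κ.twistModPk ρ hM J g x = κ.twistModP ρ hM1 J g x := by
  rw [twistModPk_apply, twistModP_apply,
    κ.unipotentPow_twistExponent_of_le (J + k) hM1 (Nat.le_add_right J k) g]

/-- **`twistModPk = twistModP` as discrete Galois modules** whenever both hypotheses are available on
`M` (`p • M = 0`, read as `p^k • M = 0`). [cite: MazurRubin2004, §5.3] -/
theorem twistModPk_eq_twistModP (hM1 : ∀ x : M, p • x = 0) :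
    κ.twistModPk ρ hM J = κ.twistModP ρ hM1 J :=
  ContinuousRep.ext fun g => LinearMap.ext fun x =>
    κ.twistModPk_apply_eq_twistModP_apply ρ hM J hM1 g x

omit hM in
/-- **The case `k = 1` IS the model**: `κ.twistModPk ρ _ J = κ.twistModP ρ hM J` for `hM : ∀ x, p • x = 0`
(read as `p ^ 1 • x = 0`). [cite: MazurRubin2004, §5.3] -/
theorem twistModPk_one_eq_twistModP (hM1 : ∀ x : M, p • x = 0) :
    κ.twistModPk ρ (k := 1) (fun x => by rw [pow_one]; exact hM1 x) J = κ.twistModP ρ hM1 J :=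
  κ.twistModPk_eq_twistModP ρ _ J hM1

/-! ### Equivariant coordinate maps: `𝒯_J^{(k)} → M` (constant coefficient), `M → 𝒯_J^{(k)}` (top coefficient) -/

/-- **The constant-coefficient map `𝒯_J^{(k)} → M`, `x ↦ x_0` (reduction modulo `T`), is
`Γ_K`-equivariant** (`(g•x)_0 = ρ(g) x_0`): `𝒯_J^{(k)}/T ≅ M` as Galois modules.  A continuous intertwining
map (Mathlib `ContIntertwiningMap`), usable in `galoisCohomology.map`. [cite: Washington1997, §13.1–§13.2] -/
def twistModPkConstCoeff (hJ : 0 < J) :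
    (κ.twistModPk ρ hM J).toContRepresentation →ⁱL ρ.toContRepresentation where
  toContinuousLinearMap :=
    { toFun := fun x => x ⟨0, hJ⟩
      map_add' := fun _ _ => rfl
      map_smul' := fun _ _ => rfl
      cont := continuous_of_discreteTopology }
  isIntertwining' g := by
    refine ContinuousLinearMap.ext fun x => ?_
    change (κ.twistModPk ρ hM J g x) ⟨0, hJ⟩ = ρ g (x ⟨0, hJ⟩)
    rw [twistModPk_apply, unipotentPow_apply_zero]

/-- Unfolding lemma for `twistModPkConstCoeff`. [cite: Washington1997, §13.1–§13.2] -/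
@[simp] theorem twistModPkConstCoeff_apply (hJ : 0 < J) (x : Fin J → M) :
    κ.twistModPkConstCoeff ρ hM J hJ x = x ⟨0, hJ⟩ := rfl

/-- **The top-coefficient inclusion `M → 𝒯_J^{(k)}`, `m ↦ m·T^{J−1}`, is `Γ_K`-equivariant**
(`g•(m T^{J−1}) = (ρ(g)m) T^{J−1}` since `T^J = 0`): `M ≅ T^{J−1}𝒯_J^{(k)} = 𝒯_J^{(k)}[T]`.
[cite: Washington1997, §13.1–§13.2] -/
def twistModPkTopCoeff (hJ : 0 < J) :
    ρ.toContRepresentation →ⁱL (κ.twistModPk ρ hM J).toContRepresentation where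
  toContinuousLinearMap :=
    { toFun := fun m => Pi.single (⟨J - 1, Nat.sub_lt hJ Nat.one_pos⟩ : Fin J) m
      map_add' := fun a b => by
        funext i
        simp only [Pi.add_apply, Pi.single_apply]
        split_ifs <;> simp
      map_smul' := fun c a => by
        funext i
        simp only [Pi.smul_apply, Pi.single_apply, RingHom.id_apply]
        split_ifs <;> simp
      cont := continuous_of_discreteTopology }
  isIntertwining' g := by
    refine ContinuousLinearMap.ext fun m => ?_
    change Pi.single _ (ρ g m) = κ.twistModPk ρ hM J g (Pi.single _ m)
    have : (fun i => ρ g ((Pi.single (⟨J - 1, Nat.sub_lt hJ Nat.one_pos⟩ : Fin J) m :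
        Fin J → M) i)) = Pi.single (⟨J - 1, Nat.sub_lt hJ Nat.one_pos⟩ : Fin J) (ρ g m) := by
      funext i
      simp only [Pi.single_apply]
      split_ifs <;> simp
    rw [twistModPk_apply, this, unipotentPow_single_top hJ]

/-- Unfolding lemma for `twistModPkTopCoeff`. [cite: Washington1997, §13.1–§13.2] -/
@[simp] theorem twistModPkTopCoeff_apply (hJ : 0 < J) (m : M) :
    κ.twistModPkTopCoeff ρ hM J hJ m = Pi.single (⟨J - 1, Nat.sub_lt hJ Nat.one_pos⟩ : Fin J) m :=
  rfl

/-! ### Truncation `𝒯_J^{(k)} → 𝒯_{J'}^{(k)}` and the `T^{J−J'}`-embedding `𝒯_{J'}^{(k)} → 𝒯_J^{(k)}` (`J' ≤ J`) -/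

section ChangeLevel

variable {J' : ℕ} (hJ' : J' ≤ J)

/-- **Truncation `𝒯_J^{(k)} → 𝒯_{J'}^{(k)}` (`J' ≤ J`), `x ↦ x mod T^{J'}`, is `Γ_K`-equivariant** — the
reduction `M ⊗ (ℤ/p^k)[T]/(T^J) → M ⊗ (ℤ/p^k)[T]/(T^{J'})` (both actions read at the common admissible
level `J + k`).  A continuous intertwining map. [cite: Washington1997, §13.1–§13.2] -/
def twistModPkTruncate :
    (κ.twistModPk ρ hM J).toContRepresentation →ⁱL (κ.twistModPk ρ hM J').toContRepresentation where
  toContinuousLinearMap :=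
    { toFun := fun x i => x (Fin.castLE hJ' i)
      map_add' := fun _ _ => rfl
      map_smul' := fun _ _ => rfl
      cont := continuous_of_discreteTopology }
  isIntertwining' g := by
    refine ContinuousLinearMap.ext fun x => ?_
    change (fun i => κ.twistModPk ρ hM J g x (Fin.castLE hJ' i)) =
      κ.twistModPk ρ hM J' g (fun i => x (Fin.castLE hJ' i))
    rw [κ.twistModPk_apply ρ hM J g x,
      κ.twistModPk_apply_of_level ρ hM J' (N := J + k) (le_prime_pow_of_le (by omega)) g]
    exact unipotentPow_comp_castLE J hJ' _ _

/-- Unfolding lemma for `twistModPkTruncate`. [cite: Washington1997, §13.1–§13.2] -/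
@[simp] theorem twistModPkTruncate_apply (x : Fin J → M) (i : Fin J') :
    κ.twistModPkTruncate ρ hM J hJ' x i = x (Fin.castLE hJ' i) := rfl

/-- **The `T^{J−J'}`-embedding `𝒯_{J'}^{(k)} → 𝒯_J^{(k)}`, `x ↦ T^{J−J'}x`, is `Γ_K`-equivariant** (its
image is `T^{J−J'}𝒯_J^{(k)} = 𝒯_J^{(k)}[T^{J'}]`); the coordinate map is the model's `shiftEmbed J hJ'`.
A continuous intertwining map. [cite: Washington1997, §13.1–§13.2] -/
def twistModPkShiftEmbed :
    (κ.twistModPk ρ hM J').toContRepresentation →ⁱL (κ.twistModPk ρ hM J).toContRepresentation where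
  toContinuousLinearMap :=
    { toFun := shiftEmbed J hJ'
      map_add' := shiftEmbed_add J hJ'
      map_smul' := fun c x => by
        funext i
        simp only [shiftEmbed_apply, Pi.smul_apply, RingHom.id_apply]
        split_ifs <;> simp
      cont := continuous_of_discreteTopology }
  isIntertwining' g := by
    refine ContinuousLinearMap.ext fun x => ?_
    change shiftEmbed J hJ' (κ.twistModPk ρ hM J' g x) = κ.twistModPk ρ hM J g (shiftEmbed J hJ' x)
    have hdiag : (fun i => ρ g (shiftEmbed J hJ' x i)) = shiftEmbed J hJ' (fun i => ρ g (x i)) := by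
      funext i
      simp only [shiftEmbed_apply]
      split_ifs <;> simp
    rw [κ.twistModPk_apply_of_level ρ hM J' (N := J + k) (le_prime_pow_of_le (by omega)) g x,
      κ.twistModPk_apply ρ hM J g (shiftEmbed J hJ' x), hdiag, unipotentPow_shiftEmbed]

/-- Unfolding lemma for `twistModPkShiftEmbed`. [cite: Washington1997, §13.1–§13.2] -/
@[simp] theorem twistModPkShiftEmbed_apply (x : Fin J' → M) :
    κ.twistModPkShiftEmbed ρ hM J hJ' x = shiftEmbed J hJ' x := rfl

end ChangeLevel

/-! ### Functoriality in `M`: equivariant maps of coefficient modules, incl. to/from the mod-`p` model -/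

section Map

variable {M' : Type u} [AddCommGroup M'] [TopologicalSpace M'] [DiscreteTopology M'] {k' : ℕ}
  (ρ' : DiscreteGaloisModule K M')

/-- **Functoriality of `𝒯_J^{(·)}` in the coefficient module**: a continuous `Γ_K`-equivariant map
`f : M → M'` (`M` killed by `p^k`, `M'` by `p^{k'}`) induces the equivariant map `x ↦ f ∘ x`,
`𝒯_J^{(k)}(M) → 𝒯_J^{(k')}(M')` (both actions read at the common admissible level `J + k + k'`; e.g. the
reduction `E[p^{k+1}] → E[p^k]`, `P ↦ p•P`, or the inclusion `E[p^k] ⊂ E[p^{k+1}]`).  A continuous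
intertwining map, usable in `galoisCohomology.map`. [cite: MazurRubin2004, §5.3] -/
def twistModPkMap (hM' : ∀ x : M', p ^ k' • x = 0)
    (f : ρ.toContRepresentation →ⁱL ρ'.toContRepresentation) :
    (κ.twistModPk ρ hM J).toContRepresentation →ⁱL (κ.twistModPk ρ' hM' J).toContRepresentation where
  toContinuousLinearMap :=
    { toFun := fun x i => f (x i)
      map_add' := fun x y => funext fun i => map_add f (x i) (y i)
      map_smul' := fun c x => funext fun i => by
        simp only [Pi.smul_apply, RingHom.id_apply, map_zsmul]
      cont := continuous_of_discreteTopology }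
  isIntertwining' g := by
    refine ContinuousLinearMap.ext fun x => ?_
    change (fun i => f (κ.twistModPk ρ hM J g x i)) = κ.twistModPk ρ' hM' J g (fun i => f (x i))
    rw [κ.twistModPk_apply_of_level ρ hM J (N := J + k + k') (le_prime_pow_of_le (by omega)) g,
      κ.twistModPk_apply_of_level ρ' hM' J (N := J + k + k') (le_prime_pow_of_le (by omega)) g,
      map_unipotentPow_apply f]
    congr 1
    funext i
    exact f.isIntertwining g (x i)

/-- Unfolding lemma for `twistModPkMap`: `(f_* x)_i = f (x_i)`. [cite: MazurRubin2004, §5.3] -/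
@[simp] theorem twistModPkMap_apply (hM' : ∀ x : M', p ^ k' • x = 0)
    (f : ρ.toContRepresentation →ⁱL ρ'.toContRepresentation) (x : Fin J → M) :
    κ.twistModPkMap ρ hM J ρ' hM' f x = fun i => f (x i) := rfl

/-- **Reduction to the mod-`p` model**: a continuous `Γ_K`-equivariant map `f : M → M'` into a module
killed by `p` (e.g. `p^{k−1}• : E[p^k] → E[p]`) induces `x ↦ f ∘ x`, `𝒯_J^{(k)}(M) → 𝒯_J(M')` INTO THE
MODEL `κ.twistModP ρ' hM' J` of `IwasawaTwistModP` (the target's exponent is read at level `J`, the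
source's at level `J + k`; they agree modulo `p^J` on a `p`-torsion module).  This is the morphism along
which the level-`p^k` towers are compared with the mod-`p` ones. [cite: MazurRubin2004, §5.3] -/
def twistModPkToModP (hM' : ∀ x : M', p • x = 0)
    (f : ρ.toContRepresentation →ⁱL ρ'.toContRepresentation) :
    (κ.twistModPk ρ hM J).toContRepresentation →ⁱL (κ.twistModP ρ' hM' J).toContRepresentation where
  toContinuousLinearMap :=
    { toFun := fun x i => f (x i)
      map_add' := fun x y => funext fun i => map_add f (x i) (y i)
      map_smul' := fun c x => funext fun i => by
        simp only [Pi.smul_apply, RingHom.id_apply, map_zsmul]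
      cont := continuous_of_discreteTopology }
  isIntertwining' g := by
    refine ContinuousLinearMap.ext fun x => ?_
    change (fun i => f (κ.twistModPk ρ hM J g x i)) = κ.twistModP ρ' hM' J g (fun i => f (x i))
    rw [twistModPk_apply, twistModP_apply, map_unipotentPow_apply f,
      κ.unipotentPow_twistExponent_of_le (J + k) hM' (Nat.le_add_right J k) g]
    congr 1
    funext i
    exact f.isIntertwining g (x i)

/-- Unfolding lemma for `twistModPkToModP`. [cite: MazurRubin2004, §5.3] -/
@[simp] theorem twistModPkToModP_apply (hM' : ∀ x : M', p • x = 0)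
    (f : ρ.toContRepresentation →ⁱL ρ'.toContRepresentation) (x : Fin J → M) :
    κ.twistModPkToModP ρ hM J ρ' hM' f x = fun i => f (x i) := rfl

omit hM in
/-- **From the mod-`p` model**: a continuous `Γ_K`-equivariant map `f : M → M'` out of a module killed by
`p` into one killed by `p^{k'}` (e.g. the inclusion `E[p] ⊂ E[p^k]`) induces `x ↦ f ∘ x`,
`𝒯_J(M) → 𝒯_J^{(k')}(M')` OUT OF THE MODEL `κ.twistModP ρ hM1 J` (equivariant because the source
coordinates are `p`-torsion, so the source exponent may be read at the target's level `J + k'`).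
[cite: MazurRubin2004, §5.3] -/
def twistModPToModPk (hM1 : ∀ x : M, p • x = 0) (hM' : ∀ x : M', p ^ k' • x = 0)
    (f : ρ.toContRepresentation →ⁱL ρ'.toContRepresentation) :
    (κ.twistModP ρ hM1 J).toContRepresentation →ⁱL (κ.twistModPk ρ' hM' J).toContRepresentation where
  toContinuousLinearMap :=
    { toFun := fun x i => f (x i)
      map_add' := fun x y => funext fun i => map_add f (x i) (y i)
      map_smul' := fun c x => funext fun i => by
        simp only [Pi.smul_apply, RingHom.id_apply, map_zsmul]
      cont := continuous_of_discreteTopology }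
  isIntertwining' g := by
    refine ContinuousLinearMap.ext fun x => ?_
    change (fun i => f (κ.twistModP ρ hM1 J g x i)) = κ.twistModPk ρ' hM' J g (fun i => f (x i))
    -- the coordinates of `x` are `p`-torsion, so the source exponent may be read at level `J + k'`
    rw [twistModP_apply, twistModPk_apply,
      ← κ.unipotentPow_twistExponent_of_le (J + k') hM1 (Nat.le_add_right J k') g,
      map_unipotentPow_apply f]
    congr 1
    funext i
    exact f.isIntertwining g (x i)

/-- Unfolding lemma for `twistModPToModPk`. [cite: MazurRubin2004, §5.3] -/
@[simp] theorem twistModPToModPk_apply (hM1 : ∀ x : M, p • x = 0) (hM' : ∀ x : M', p ^ k' • x = 0)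
    (f : ρ.toContRepresentation →ⁱL ρ'.toContRepresentation) (x : Fin J → M) :
    κ.twistModPToModPk ρ J ρ' hM1 hM' f x = fun i => f (x i) := rfl

end Map

end ZpExtension

end Literature.NumberTheory.EllipticCurves

/-! ## The case of an elliptic curve: `𝒯_J^{(k)}(E, p, κ) = E[p^k] ⊗ (ℤ/p^k)[T]/(T^J)(χ_κ)` -/

namespace WeierstrassCurve

open Literature.NumberTheory.EllipticCurves Literature.NumberTheory.GaloisRepresentations

variable {F : Type u} [Field F] (W : WeierstrassCurve F) (p : ℕ) [Fact p.Prime] (k : ℕ)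
  (κ : ZpExtension F p) (J : ℕ)

omit [Fact p.Prime] in
/-- `E[p^k] = geomTorsion W ((p : ℤ) ^ k)` is killed by `p^k` (the hypothesis `hM` of the level-`p^k`
twists; `AddSubgroup.torsionBy.nsmul_iff` up to the cast `((p ^ k : ℕ) : ℤ) = (p : ℤ) ^ k`) — the
definition of `E[m] = {P : [m]P = O}` (Silverman, *AEC*, III.§4, p. 69) at `m = p^k`.
[cite: SilvermanAEC2009, III.§4 (Definition of E[m])] -/
theorem pow_nsmul_geomTorsion_eq_zero (P : geomTorsion W ((p : ℤ) ^ k)) : p ^ k • P = 0 := by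
  have h1 : (P : geomPoints W) ∈ AddSubgroup.torsionBy (geomPoints W) ((p ^ k : ℕ) : ℤ) := by
    rw [Nat.cast_pow]
    exact P.2
  have h2 : p ^ k • (P : geomPoints W) = 0 := AddSubgroup.torsionBy.nsmul_iff.mp h1
  exact Subtype.ext (by rw [AddSubgroupClass.coe_nsmul, ZeroMemClass.coe_zero]; exact h2)

/-- **`𝒯_J^{(k)}(E) := E[p^k] ⊗ (ℤ/p^k)[T]/(T^J)(χ_κ)`** for a Weierstrass curve `W` over a field `F`, a
prime `p`, a level `k` and a `ℤ_p`-extension `κ` of `F`: the mod-`(p^k, T^J)` Iwasawa twist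
(`ZpExtension.twistModPk`) of the discrete Galois module `E[p^k] = W.torsionGaloisModule ((p : ℤ) ^ k)`
(file `GeomPointsGaloisModule`; the tree's spelling of `E[p^k]`, as in `Kato2004/IwasawaH1ReductionPk`), on
`Fin J → E[p^k]`.  For `F = ℚ`, `κ` cyclotomic and `k = n + 1` these are the coefficient modules
`T/(p^{n+1}, T^J)` of the level-`p^{n+1}` graded core of MEMO-es §15/§25. [cite: MazurRubin2004, §5.3] -/
def modPkTwist : DiscreteGaloisModule F (Fin J → geomTorsion W ((p : ℤ) ^ k)) :=
  κ.twistModPk (W.torsionGaloisModule ((p : ℤ) ^ k)) (W.pow_nsmul_geomTorsion_eq_zero p k) J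

/-- Unfolding lemma: on `𝒯_J^{(k)}(E)`, `σ ∈ Γ_F` acts by `(1+S)^{κ(σ) mod p^{J+k}}` after `σ`
coordinatewise on `E[p^k]`. [cite: MazurRubin2004, §5.3] -/
theorem modPkTwist_apply (σ : absoluteGaloisGroup F) (x : Fin J → geomTorsion W ((p : ℤ) ^ k)) :
    W.modPkTwist p k κ J σ x =
      unipotentPow (geomTorsion W ((p : ℤ) ^ k)) J (κ.twistExponent (J + k) σ) (fun i => σ • x i) :=
  rfl

/-- On `𝒯_J^{(k)}(E)`, a topological generator `γ` of `κ` acts by `(1+S) ∘ γ`: `T = γ − 1`.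
[cite: Washington1997, §13.1–§13.2] -/
theorem modPkTwist_apply_of_isTopGenerator {γ : absoluteGaloisGroup F} (hγ : κ.IsTopGenerator γ)
    (x : Fin J → geomTorsion W ((p : ℤ) ^ k)) :
    W.modPkTwist p k κ J γ x = (1 + shiftEnd (geomTorsion W ((p : ℤ) ^ k)) J) (fun i => γ • x i) :=
  ZpExtension.twistModPk_apply_of_isTopGenerator κ _ _ J hγ x

/-- On `𝒯_J^{(k)}(E)`, `Gal(F̄/F_m)` (`κ.layerSubgroup m`) acts through `E[p^k]` alone when
`J ≤ p^{m+1−k}`. [cite: Washington1997, §13.1–§13.2] -/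
theorem modPkTwist_apply_of_mem_layerSubgroup {m : ℕ} (hJ : J ≤ p ^ (m + 1 - k))
    {σ : absoluteGaloisGroup F} (hσ : σ ∈ κ.layerSubgroup m)
    (x : Fin J → geomTorsion W ((p : ℤ) ^ k)) :
    W.modPkTwist p k κ J σ x = fun i => σ • x i :=
  ZpExtension.twistModPk_apply_of_mem_layerSubgroup κ _ _ J hJ hσ x

end WeierstrassCurve

end
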